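import Summits.AtomisticToContinuum.BoseEinsteinCondensation.Theorems.BECGroundStateSOSPeriodicIRBoundFsumDCPotSlot
import Summits.AtomisticToContinuum.BoseEinsteinCondensation.Theorems.BECGroundStateSOSPeriodicIRBoundFsumDCPotPair
import HarnessLib

/-!
# Crux `PeriodicIRBound` (stmt-AtomisticToContinuum-3972), line `fsum-phase-pencil`, stub S3
# `stub_phaseDoubleCommutator` — potential part, C: far lifts are moved across the pair form as adjoints

For a particle `j ∉ {0, 1}` the pair weight `w^per(x_0 − x_1)` of `pairForm` does not see `x_j`, so the slot
lift `|φ_a⟩⟨φ_b|_j` (`slotLift L j a b`, part A) moves across the pair form as its adjoint `|φ_b⟩⟨φ_a|_j`: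
`pairForm (slotLift j a b F) G = pairForm F (slotLift j b a G)` (Fubini on `cell^{m+3} ≅ cell × cell^{m+2}` at
slot `j`, then on `cell × cell` for the two cell variables `x_j`, `y`). Summing over `j ∈ S ⊆ {0, 1}ᶜ` with the
sesquilinearity of part B: `pairForm (liftOp S a b c d F) G = pairForm F (liftOp S b a d c G)` — registered
helper stub `stub_fsumDCPotAdj`.
-/

noncomputable section

open MeasureTheory Filter
open scoped ENNReal NNReal ComplexConjugate BigOperators

namespace Summit.AtomisticToContinuum.BoseEinsteinCondensation.Cruxes.PeriodicIRBound.FsumPhasePencil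

open Literature.MathematicalPhysics.QuantumManyBody.BoseGas
open Summit.AtomisticToContinuum.BoseEinsteinCondensation.Cruxes.PeriodicIRBound.LinearPhFloorWagner.WF

variable {m n : ℕ} {L : ℝ}

/-! ## Fubini at slot `j` -/

/-- **Splitting off particle `j`** (Bochner Fubini on `cell^{n+1} ≅ cell × cell^n` at slot `j`,
`measurePreserving_piFinSuccAbove_cellN`): for `K` integrable on the cell,
`∫_{cell^{n+1}} K = ∫_{Y ∈ cell^n} ∫_{x ∈ cell} K(Z_Y[j ↦ x])`, `Z_Y = insertNth j 0 Y`. [folklore] -/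
theorem integral_cellN_eq_integral_update (j : Fin (n + 1)) (L : ℝ) {K : Config (n + 1) → ℂ}
    (hK : IntegrableOn K (cellN (n + 1) L) volume) :
    ∫ X in cellN (n + 1) L, K X =
      ∫ Y in cellN n L, ∫ x in cell L, K (Function.update (j.insertNth 0 Y) j x) := by
  have he := (measurePreserving_piFinSuccAbove_cellN (n := n) j L).symm
    (MeasurableEquiv.piFinSuccAbove (fun _ : Fin (n + 1) => Space) j)
  have hes : ∀ p : Space × Config n,
      (MeasurableEquiv.piFinSuccAbove (fun _ : Fin (n + 1) => Space) j).symm p = j.insertNth p.1 p.2 :=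
    fun _ => rfl
  have hint : Integrable (fun p : Space × Config n => K (j.insertNth p.1 p.2))
      (((volume : Measure Space).restrict (cell L)).prod
        ((volume : Measure (Config n)).restrict (cellN n L))) := by
    have h := (he.integrable_comp_emb (MeasurableEquiv.measurableEmbedding _) (g := K)).2 hK
    refine h.congr (Eventually.of_forall fun p => ?_)
    simp only [Function.comp_apply, hes]
  rw [← he.integral_comp' K]
  simp only [hes, Fin.update_insertNth]
  exact integral_prod_symm _ hint

/-- The Fubini hypothesis on `cell × cell`: `(x, z) ↦ c A(x) B(z)` is integrable for continuous `A, B`. [folklore] -/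
theorem integrable_uncurry_cell_prod_cell (c : ℂ) {A B : Space → ℂ} (hA : Continuous A) (hB : Continuous B) :
    Integrable (Function.uncurry fun x z => c * (A x * B z))
      (((volume : Measure Space).restrict (cell L)).prod ((volume : Measure Space).restrict (cell L))) := by
  rw [Measure.prod_restrict]
  change IntegrableOn (fun p : Space × Space => c * (A p.1 * B p.2)) (cell L ×ˢ cell L) (volume.prod volume)
  exact integrableOn_of_continuous_of_isBounded ((isBounded_cell L).prod (isBounded_cell L))
    (continuous_const.mul ((hA.comp continuous_fst).mul (hB.comp continuous_snd)))

/-! ## One far slot -/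

section Far

variable {w : ℝ → ℝ≥0∞} {j : Fin (m + 3)} (h0j : (0 : Fin (m + 3)) ≠ j) (h1j : (1 : Fin (m + 3)) ≠ j)
include h0j h1j

/-- The left integrand at `Z[j ↦ x]` as a cell integral: `w^per(z_0 − z_1) conj(|φ_a⟩⟨φ_b|_j F) G` at `Z[j ↦ x]`
is `∫_z w^per(z_0 − z_1) conj(φ_a(x)) G(Z[j ↦ x]) φ_b(z) conj(F(Z[j ↦ z])) dz` (the weight does not see slot
`j ∉ {0, 1}`). [folklore] -/
theorem pairWeight_conj_slotLift_mul_update (a b : Fin 3 → ℤ) (F G : Config (m + 3) → ℂ) (Z : Config (m + 3))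
    (x : Space) :
    ((periodizedPotential w L (Function.update Z j x 0 - Function.update Z j x 1)).toReal : ℂ) *
        (conj (slotLift L j a b F (Function.update Z j x)) * G (Function.update Z j x)) =
      ∫ z in cell L, ((periodizedPotential w L (Z 0 - Z 1)).toReal : ℂ) *
        ((conj (planeWaveMode L a x) * G (Function.update Z j x)) *
          (planeWaveMode L b z * conj (F (Function.update Z j z)))) := by
  rw [slotLift_apply, Function.update_self, Function.update_of_ne h0j, Function.update_of_ne h1j, map_mul,
    ← integral_conj]
  simp only [Function.update_idem, map_mul, Complex.conj_conj]
  rw [integral_const_mul, integral_const_mul]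
  ring

/-- The right integrand at `Z[j ↦ x]` as a cell integral: `w^per(z_0 − z_1) conj(F) |φ_b⟩⟨φ_a|_j G` at
`Z[j ↦ x]` is `∫_y w^per(z_0 − z_1) conj(F(Z[j ↦ x])) φ_b(x) conj(φ_a(y)) G(Z[j ↦ y]) dy`. [folklore] -/
theorem pairWeight_conj_mul_slotLift_update (a b : Fin 3 → ℤ) (F G : Config (m + 3) → ℂ) (Z : Config (m + 3))
    (x : Space) :
    ((periodizedPotential w L (Function.update Z j x 0 - Function.update Z j x 1)).toReal : ℂ) *
        (conj (F (Function.update Z j x)) * slotLift L j b a G (Function.update Z j x)) =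
      ∫ y in cell L, ((periodizedPotential w L (Z 0 - Z 1)).toReal : ℂ) *
        ((conj (F (Function.update Z j x)) * planeWaveMode L b x) *
          (conj (planeWaveMode L a y) * G (Function.update Z j y))) := by
  rw [slotLift_apply, Function.update_self, Function.update_of_ne h0j, Function.update_of_ne h1j]
  simp only [Function.update_idem]
  rw [integral_const_mul, integral_const_mul]
  ring

/-- **Exchange of the two cell variables** (Fubini on `cell × cell`): the slot-`j` fibres of the two pair-form
integrands `w conj(|φ_a⟩⟨φ_b|_j F) G` and `w conj(F) |φ_b⟩⟨φ_a|_j G` over the base configuration `Z` agree,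
for continuous `F, G`. [folklore] -/
theorem integral_cell_pairWeight_slotLift_update {F G : Config (m + 3) → ℂ} (hF : Continuous F) (hG : Continuous G)
    (a b : Fin 3 → ℤ) (Z : Config (m + 3)) :
    ∫ x in cell L, ((periodizedPotential w L (Function.update Z j x 0 - Function.update Z j x 1)).toReal : ℂ) *
        (conj (slotLift L j a b F (Function.update Z j x)) * G (Function.update Z j x)) =
      ∫ x in cell L, ((periodizedPotential w L (Function.update Z j x 0 - Function.update Z j x 1)).toReal : ℂ) *
        (conj (F (Function.update Z j x)) * slotLift L j b a G (Function.update Z j x)) := by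
  simp only [pairWeight_conj_slotLift_mul_update h0j h1j, pairWeight_conj_mul_slotLift_update h0j h1j]
  have hA : Continuous fun x : Space => conj (planeWaveMode L a x) * G (Function.update Z j x) :=
    (Complex.continuous_conj.comp (continuous_planeWaveMode L a)).mul (hG.comp (continuous_const.update j continuous_id))
  have hB : Continuous fun z : Space => planeWaveMode L b z * conj (F (Function.update Z j z)) :=
    (continuous_planeWaveMode L b).mul (Complex.continuous_conj.comp (hF.comp (continuous_const.update j continuous_id)))
  rw [integral_integral_swap
    (integrable_uncurry_cell_prod_cell ((periodizedPotential w L (Z 0 - Z 1)).toReal : ℂ) hA hB)]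
  refine integral_congr_ae (Eventually.of_forall fun u => integral_congr_ae (Eventually.of_forall fun v => ?_))
  ring

variable (hL : 0 < L) (hw : Measurable w) (hint : (∫⁻ z : Space, w ‖z‖) ≠ ⊤)
include hL hw hint

/-- **A far slot lift moves across the pair form as its adjoint**: for `j ∉ {0, 1}` and continuous `F, G`,
`pairForm (slotLift j a b F) G = pairForm F (slotLift j b a G)` (the weight `w^per(x_0 − x_1)` does not see
`x_j`; Fubini at slot `j`, then the two cell variables `x_j, y` are exchanged on `cell × cell`). [folklore] -/
theorem pairForm_slotLift_far (a b : Fin 3 → ℤ) {F G : Config (m + 3) → ℂ} (hF : Continuous F) (hG : Continuous G) :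
    pairForm w L (slotLift L j a b F) G = pairForm w L F (slotLift L j b a G) := by
  unfold pairForm
  rw [integral_cellN_eq_integral_update j L
      (integrable_pairForm_integrand hL hw hint (continuous_slotLift L j a b hF) hG),
    integral_cellN_eq_integral_update j L
      (integrable_pairForm_integrand hL hw hint hF (continuous_slotLift L j b a hG))]
  exact integral_congr_ae (Eventually.of_forall fun Y =>
    integral_cell_pairWeight_slotLift_update h0j h1j hF hG a b _)

/-! ## The far lift `liftOp S`, `S ∌ 0, 1` -/

omit h0j h1j in
/-- **Far-lift adjointness across the pair form**: for `S ∌ 0, 1` and continuous `F, G`,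
`pairForm (liftOp S a b c d F) G = pairForm F (liftOp S b a d c G)` (`(|φ_a⟩⟨φ_b| − |φ_c⟩⟨φ_d|)† =
|φ_b⟩⟨φ_a| − |φ_d⟩⟨φ_c|` slot by slot, `pairForm_slotLift_far`, and sesquilinearity). [folklore] -/
theorem pairForm_liftOp_far {S : Finset (Fin (m + 3))} (h0 : (0 : Fin (m + 3)) ∉ S) (h1 : (1 : Fin (m + 3)) ∉ S)
    (a b c d : Fin 3 → ℤ) {F G : Config (m + 3) → ℂ} (hF : Continuous F) (hG : Continuous G) :
    pairForm w L (liftOp L S a b c d F) G = pairForm w L F (liftOp L S b a d c G) := by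
  have hFt : ∀ i ∈ S, Continuous fun X => slotLift L i a b F X - slotLift L i c d F X := fun i _ =>
    (continuous_slotLift L i a b hF).sub (continuous_slotLift L i c d hF)
  have hGt : ∀ i ∈ S, Continuous fun X => slotLift L i b a G X - slotLift L i d c G X := fun i _ =>
    (continuous_slotLift L i b a hG).sub (continuous_slotLift L i d c hG)
  change pairForm w L (fun X => ∑ i ∈ S, (slotLift L i a b F X - slotLift L i c d F X)) G =
    pairForm w L F (fun X => ∑ i ∈ S, (slotLift L i b a G X - slotLift L i d c G X))
  rw [pairForm_finset_sum_left hL hw hint S hFt hG, pairForm_finset_sum_right hL hw hint S hF hGt]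
  refine Finset.sum_congr rfl fun i hi => ?_
  have h0i : (0 : Fin (m + 3)) ≠ i := fun h => h0 (by rw [h]; exact hi)
  have h1i : (1 : Fin (m + 3)) ≠ i := fun h => h1 (by rw [h]; exact hi)
  rw [pairForm_sub_left hL hw hint (continuous_slotLift L i a b hF) (continuous_slotLift L i c d hF) hG,
    pairForm_sub_right hL hw hint hF (continuous_slotLift L i b a hG) (continuous_slotLift L i d c hG),
    pairForm_slotLift_far h0i h1i hL hw hint a b hF hG, pairForm_slotLift_far h0i h1i hL hw hint c d hF hG]

end Far

/-! ## Registered headline -/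

/-- **Registered helper stub `stub_fsumDCPotAdj`** (line `fsum-phase-pencil`, S3 potential part C): far lifts
(`S ∌ 0, 1`) move across the pair form as their adjoints, `pairForm_liftOp_far`. [folklore] -/
theorem stub_fsumDCPotAdj : ∀ {m : ℕ} {L : ℝ} {w : ℝ → ℝ≥0∞}, 0 < L → Measurable w → (∫⁻ z : Space, w ‖z‖) ≠ ⊤ → ∀ {S : Finset (Fin (m + 3))}, (0 : Fin (m + 3)) ∉ S → (1 : Fin (m + 3)) ∉ S → ∀ (a b c d : Fin 3 → ℤ) {F G : Config (m + 3) → ℂ}, Continuous F → Continuous G → pairForm w L (liftOp L S a b c d F) G = pairForm w L F (liftOp L S b a d c G) :=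
  fun hL hw hint _ h0 h1 a b c d _ _ hF hG => pairForm_liftOp_far hL hw hint h0 h1 a b c d hF hG

end Summit.AtomisticToContinuum.BoseEinsteinCondensation.Cruxes.PeriodicIRBound.FsumPhasePencil

end
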